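import Summits.BirchSwinnertonDyer.BirchSwinnertonDyer.Theorems.CyclotomicUntwistWildThreeSplitCubeDiscriminant
import Literature.NumberTheory.EllipticCurves.ThreeTorsionRadicalProofs
import Literature.NumberTheory.EllipticCurves.ThreeTorsionRadicalsProofs
import HarnessLib

/-!
# The CONVERSE: a cube discriminant and ONE rational root of `Ψ₃` give a SECOND rational root
# (any field of characteristic `0`); hence SPLIT at `3` ⟺ `Δ ∈ (ℚ₃ˣ)³ ∧ Ψ₃` has a `ℚ₃`-root

Cell `pub/bsd-wall` (D-0145 line `route-BirchSwinnertonDyer-CyclotomicUntwist`), seat `bsd-line-cycu-p2`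
(prover seat 2/3, gen 4); helper toward K1/K2 (stmt-BirchSwinnertonDyer-21580 / 21581) and the O6 lane (V10
shapes of `W[3]|G_{ℚ₃}`). THEOREMS ONLY (no definition, no named fact, no `sorry`); BSD is not proved by this
file and no crux is.

## What
**`exists_second_root_of_Δ_eq_cube`**: over a field `K` of characteristic `0`, if `Δ(W) = d³` with `d ∈ K`
and `Ψ₃(r) = 0` for some `r ∈ K`, then `Ψ₃(r') = 0` for some `r' ∈ K`, `r' ≠ r`. Proof (Serre's radicals,
the tree's `eval_Ψ₃_eq_zero_iff_radical` / `radical_sq_ne`, in an algebraic closure `L ⊇ K` with the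
RATIONAL cube root `δ = d`): `12r + b₂ = U₀ + U₁ + U₂` for square roots `U_k² = c₄ − 12ωᵏd`, `U₀U₁U₂ = c₆`;
the partner `12r' + b₂ = U₀ − U₁ − U₂` is a root, distinct from `r`, and RATIONAL because
`U₀·((12r + b₂)² − c₄ − 24d) = 2(c₆ + (12r + b₂)(c₄ − 12d))` (`key_identity`, one `linear_combination`)
pins `U₀ ∈ K` — in the degenerate case `(12r+b₂)² = c₄ + 24d` the `c`-relation forces `c₄ = 12d`, `U₀ = 0`.
With the seat's `Δ_eq_neg_cube_of_Ψ₃_roots` (two roots ⟹ cube): **`two_roots_iff_cube_and_root`** — over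
`ℚ₃` (indeed any characteristic-`0` field) `Ψ₃` has two distinct roots iff `Δ` is a cube and `Ψ₃` has a root;
for curves over `ℚ`: **`shapeSplitThree_iff_cube_and_not_shapeIrrThree`** (SPLIT ⟺ `Δ ∈ (ℚ₃ˣ)³ ∧ ¬IRR`).
References: J.-P. Serre, Invent. Math. 15 (1972) §5.3 [Serre1972]; J. H. Silverman, *AEC* (2009) III.1,
Ex. 3.7 [SilvermanAEC2009].
-/

set_option autoImplicit false
-- single-conjunct summit: `Summit.BirchSwinnertonDyer.BirchSwinnertonDyer.…` repeats the name by design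
set_option linter.dupNamespace false

noncomputable section

open scoped Classical

open Polynomial WeierstrassCurve Literature.NumberTheory.EllipticCurves
  Literature.NumberTheory.EllipticCurves.ThreeTorsionRadicals
  Summit.BirchSwinnertonDyer.Rank1Residual.Additive

namespace Summit.BirchSwinnertonDyer.BirchSwinnertonDyer.Theorems.PSLocalThreeTorsion

/-! ## §1 The key identity on radical data -/

section Identity

variable {F : Type*} [Field F]

/-- **`U₀·(S² − c₄ − 24δ) = 2(c₆ + S(c₄ − 12δ))`** for `S = U₀ + U₁ + U₂` on radical data
(`ω² + ω + 1 = 0`, `U_k² = c₄ − 12ωᵏδ`, `U₀U₁U₂ = c₆`): the partner sum `U₁ + U₂ = S − U₀` squares into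
`K(U₀)`, which pins `U₀`. [cite: Serre1972, §5.3] -/
theorem key_identity {ω δ U₀ U₁ U₂ c₄ c₆ : F} (hω : ω ^ 2 + ω + 1 = 0) (h₀ : U₀ ^ 2 = c₄ - 12 * δ)
    (h₁ : U₁ ^ 2 = c₄ - 12 * ω * δ) (h₂ : U₂ ^ 2 = c₄ - 12 * ω ^ 2 * δ) (hρ : U₀ * U₁ * U₂ = c₆) :
    U₀ * ((U₀ + U₁ + U₂) ^ 2 - c₄ - 24 * δ) = 2 * (c₆ + (U₀ + U₁ + U₂) * (c₄ - 12 * δ)) := by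
  linear_combination (2 * (U₀ + U₁ + U₂) - U₀) * h₀ + U₀ * h₁ + U₀ * h₂ + 2 * hρ +
    (-12 * δ * U₀) * hω

end Identity

/-! ## §2 One root and a cube discriminant give a second root -/

section Converse

variable {K : Type*} [Field K] [CharZero K] (W : WeierstrassCurve K) [W.IsElliptic]

/-- **A cube discriminant and one `K`-root of `Ψ₃` give a second `K`-root** (`K` of characteristic `0`).
[cite: Serre1972, §5.3] [cite: SilvermanAEC2009, Exercise 3.7] -/
theorem exists_second_root_of_Δ_eq_cube {d r : K} (hd : W.Δ = d ^ 3) (hr : W.Ψ₃.eval r = 0) :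
    ∃ r' : K, r' ≠ r ∧ W.Ψ₃.eval r' = 0 := by
  let L := AlgebraicClosure K
  let ι : K →+* L := algebraMap K L
  have hι : Function.Injective ι := (algebraMap K L).injective
  set V : WeierstrassCurve L := W.map ι with hV
  have hb₂ : V.b₂ = ι W.b₂ := by rw [hV, map_b₂]
  have hc₄ : V.c₄ = ι W.c₄ := by rw [hV, map_c₄]
  have hc₆ : V.c₆ = ι W.c₆ := by rw [hV, map_c₆]
  have hΔ : V.Δ = ι W.Δ := by rw [hV, map_Δ]
  have h2 : (2 : L) ≠ 0 := by
    rw [show (2 : L) = ι 2 from (map_ofNat ι 2).symm]; exact (map_ne_zero ι).mpr two_ne_zero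
  have h3 : (3 : L) ≠ 0 := by
    rw [show (3 : L) = ι 3 from (map_ofNat ι 3).symm]; exact (map_ne_zero ι).mpr three_ne_zero
  have hdiv : ∀ N : L, 12 * (N / 12) = N := fun N ↦ by
    rw [mul_comm]; exact div_mul_cancel₀ N (by
      rw [show (12 : L) = 2 * 2 * 3 by norm_num]; exact mul_ne_zero (mul_ne_zero h2 h2) h3)
  have hd0 : d ≠ 0 := by
    intro h0; apply W.isUnit_Δ.ne_zero; rw [hd, h0]; ring
  set δ : L := ι d with hδ
  have hδ0 : δ ≠ 0 := (map_ne_zero ι).mpr hd0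
  have hδ3 : δ ^ 3 = V.Δ := by rw [hΔ, hd, map_pow]
  -- radical data in `L` with the RATIONAL cube root `δ`
  obtain ⟨ω, hω⟩ : ∃ ω : L, ω ^ 2 + ω + 1 = 0 := by
    have hdeg : (C 1 * X ^ 2 + C 1 * X + C 1 : L[X]).degree = 2 := degree_quadratic one_ne_zero
    obtain ⟨ω, hω⟩ := IsAlgClosed.exists_root (C 1 * X ^ 2 + C 1 * X + C 1 : L[X])
      (by rw [hdeg]; decide)
    refine ⟨ω, ?_⟩
    have := hω.eq_zero
    simpa using this
  obtain ⟨U₀, hU₀⟩ := IsAlgClosed.exists_pow_nat_eq (V.c₄ - 12 * δ) (by norm_num : 0 < 2)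
  obtain ⟨U₁, hU₁⟩ := IsAlgClosed.exists_pow_nat_eq (V.c₄ - 12 * ω * δ) (by norm_num : 0 < 2)
  obtain ⟨V₂, hV₂⟩ := IsAlgClosed.exists_pow_nat_eq (V.c₄ - 12 * ω ^ 2 * δ) (by norm_num : 0 < 2)
  have hprod : (U₀ * U₁ * V₂) ^ 2 = V.c₆ ^ 2 := by
    have e := prod_c₄_sub_twelve_mul (c₄ := V.c₄) (δ := δ) hω
    rw [mul_pow, mul_pow, hU₀, hU₁, hV₂, e, hδ3]
    linear_combination -V.c_relation
  obtain ⟨U₂, hU₂, hρ⟩ : ∃ U₂ : L, U₂ ^ 2 = V.c₄ - 12 * ω ^ 2 * δ ∧ U₀ * U₁ * U₂ = V.c₆ := by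
    rcases sq_eq_sq_iff_eq_or_eq_neg.mp hprod with h | h
    · exact ⟨V₂, hV₂, h⟩
    · exact ⟨-V₂, by rw [neg_sq, hV₂], by rw [mul_neg, h, neg_neg]⟩
  -- the given root in radical form; re-sign the data so that all signs are `+`
  set x : L := ι r with hx
  have hxr : V.Ψ₃.eval x = 0 := by
    rw [hV, map_Ψ₃, eval_map, eval₂_at_apply, hr, map_zero]
  obtain ⟨ε₀, ε₁, ε₂, hε₀, hε₁, hε₂, hεp, h12x⟩ :=
    (V.eval_Ψ₃_eq_zero_iff_radical h2 h3 hω hδ0 hU₀ hU₁ hU₂ hρ x).mp hxr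
  have sq1 : ∀ ε : L, (ε = 1 ∨ ε = -1) → ε ^ 2 = 1 := by
    rintro ε (rfl | rfl) <;> norm_num
  set T₀ := ε₀ * U₀ with hT₀
  set T₁ := ε₁ * U₁ with hT₁
  set T₂ := ε₂ * U₂ with hT₂
  have hT₀' : T₀ ^ 2 = V.c₄ - 12 * δ := by rw [hT₀, mul_pow, sq1 ε₀ hε₀, one_mul, hU₀]
  have hT₁' : T₁ ^ 2 = V.c₄ - 12 * ω * δ := by rw [hT₁, mul_pow, sq1 ε₁ hε₁, one_mul, hU₁]
  have hT₂' : T₂ ^ 2 = V.c₄ - 12 * ω ^ 2 * δ := by rw [hT₂, mul_pow, sq1 ε₂ hε₂, one_mul, hU₂]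
  have hTρ : T₀ * T₁ * T₂ = V.c₆ := by
    rw [hT₀, hT₁, hT₂, show ε₀ * U₀ * (ε₁ * U₁) * (ε₂ * U₂) = (ε₀ * ε₁ * ε₂) * (U₀ * U₁ * U₂) by ring,
      hεp, one_mul, hρ]
  have hS : 12 * x = -V.b₂ + T₀ + T₁ + T₂ := by rw [hT₀, hT₁, hT₂]; exact h12x
  -- the partner root
  set x₂ : L := (-V.b₂ + T₀ - T₁ - T₂) / 12 with hx₂
  have hx₂r : V.Ψ₃.eval x₂ = 0 :=
    (V.eval_Ψ₃_eq_zero_iff_radical h2 h3 hω hδ0 hT₀' hT₁' hT₂' hTρ x₂).mpr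
      ⟨1, -1, -1, Or.inl rfl, Or.inr rfl, Or.inr rfl, by norm_num, by rw [hx₂, hdiv]; ring⟩
  have hne : x₂ ≠ x := by
    intro h
    obtain ⟨-, -, h12'⟩ := V.radical_sq_ne h2 h3 hω hδ0 hT₀' hT₁' hT₂'
    apply h12'
    have hsum : T₁ + T₂ = 0 := by
      have e1 : 12 * x₂ = -V.b₂ + T₀ - T₁ - T₂ := by rw [hx₂, hdiv]
      have : (2 : L) * (T₁ + T₂) = 0 := by linear_combination -hS + e1 - 12 * h
      exact (mul_eq_zero.mp this).resolve_left h2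
    have : T₁ = -T₂ := by linear_combination hsum
    rw [this, neg_sq]
  -- `T₀` is rational: `T₀ · ι(M) = ι(2(c₆ + sA))`
  set s : K := 12 * r + W.b₂ with hs
  set A : K := W.c₄ - 12 * d with hA
  set M : K := s ^ 2 - W.c₄ - 24 * d with hM
  have hSs : T₀ + T₁ + T₂ = ι s := by
    rw [hs, map_add, map_mul, map_ofNat, ← hx, ← hb₂]; linear_combination -hS
  have hkey := key_identity hω hT₀' hT₁' hT₂' hTρ
  have hkey' : T₀ * ι M = ι (2 * (W.c₆ + s * A)) := by
    rw [hM, hA]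
    simp only [map_sub, map_mul, map_pow, map_add, map_ofNat]
    rw [← hSs, ← hc₄, ← hc₆, ← hδ]
    exact hkey
  have hA' : T₀ ^ 2 = ι A := by rw [hT₀', hA, map_sub, map_mul, map_ofNat, hc₄, hδ]
  obtain ⟨u, hu⟩ : ∃ u : K, ι u = T₀ := by
    by_cases hM0 : M = 0
    · -- degenerate case: `c₆ = −sA`, then the `c`-relation forces `c₄ = 12d`, so `A = 0`, `T₀ = 0`
      refine ⟨0, ?_⟩
      have h0 : W.c₆ + s * A = 0 := by
        have : ι (2 * (W.c₆ + s * A)) = 0 := by rw [← hkey', hM0, map_zero, mul_zero]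
        have h' : 2 * (W.c₆ + s * A) = 0 := hι (by rw [this, map_zero])
        exact (mul_eq_zero.mp h').resolve_left two_ne_zero
      have hc6 : W.c₆ = -(s * (W.c₄ - 12 * d)) := by rw [← hA]; linear_combination h0
      have hM' : s ^ 2 = W.c₄ + 24 * d := by rw [hM] at hM0; linear_combination hM0
      have hrel : 1728 * d ^ 3 = W.c₄ ^ 3 - W.c₆ ^ 2 := by rw [← hd]; exact W.c_relation
      have hcub : 432 * d ^ 2 * (12 * d - W.c₄) = 0 := by
        linear_combination hrel + (s * (W.c₄ - 12 * d) - W.c₆) * hc6 - (W.c₄ - 12 * d) ^ 2 * hM'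
      have hA0 : A = 0 := by
        rcases mul_eq_zero.mp hcub with h | h
        · exact absurd h (mul_ne_zero (by norm_num) (pow_ne_zero 2 hd0))
        · rw [hA]; linear_combination -h
      have hsq0 : T₀ ^ 2 = 0 := by rw [hA', hA0, map_zero]
      have hT00 : T₀ = 0 := (pow_eq_zero_iff two_ne_zero).mp hsq0
      rw [map_zero, hT00]
    · refine ⟨2 * (W.c₆ + s * A) / M, ?_⟩
      have hιM : ι M ≠ 0 := (map_ne_zero ι).mpr hM0
      rw [map_div₀, ← hkey', mul_div_cancel_right₀ _ hιM]
  -- the second root, back in `K`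
  have hnum : ι (2 * u - 2 * W.b₂ - 12 * r) = -V.b₂ + T₀ - T₁ - T₂ := by
    simp only [map_sub, map_mul, map_ofNat]
    rw [hu, ← hb₂, ← hx]
    linear_combination -hS
  have hx₂' : ι ((2 * u - 2 * W.b₂ - 12 * r) / 12) = x₂ := by
    rw [map_div₀, hnum, map_ofNat, hx₂]
  refine ⟨(2 * u - 2 * W.b₂ - 12 * r) / 12, ?_, ?_⟩
  · -- distinct from `r`
    intro h
    apply hne
    rw [← hx₂', h]
  · -- a root
    apply hι
    rw [map_zero, ← eval₂_at_apply, ← eval_map, ← map_Ψ₃, ← hV, hx₂', hx₂r]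

/-- **Two distinct roots of `Ψ₃` ⟺ `Δ` is a cube and `Ψ₃` has a root** (`K` of characteristic `0`).
[cite: Serre1972, §5.3] -/
theorem two_roots_iff_cube_and_root :
    (∃ r r' : K, r ≠ r' ∧ W.Ψ₃.eval r = 0 ∧ W.Ψ₃.eval r' = 0) ↔
      (∃ d : K, W.Δ = d ^ 3) ∧ ∃ r : K, W.Ψ₃.eval r = 0 := by
  constructor
  · rintro ⟨r, r', hne, hr, hr'⟩
    exact ⟨exists_Δ_eq_cube_of_Ψ₃_roots W hne hr hr', r, hr⟩
  · rintro ⟨⟨d, hd⟩, r, hr⟩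
    obtain ⟨r', hne, hr'⟩ := exists_second_root_of_Δ_eq_cube W hd hr
    exact ⟨r, r', hne.symm, hr, hr'⟩

end Converse

/-! ## §3 Curves over `ℚ`: SPLIT at `3` ⟺ cube discriminant and not IRR -/

section Curves

variable (W : WeierstrassCurve ℚ) [W.IsElliptic]

/-- **SPLIT ⟺ `Δ ∈ (ℚ₃ˣ)³` ∧ ¬IRR** at `3`, for every elliptic curve over `ℚ` (any model).
[cite: Serre1972, §5.3] -/
theorem shapeSplitThree_iff_cube_and_not_shapeIrrThree :
    ShapeSplitThree W ↔ (∃ d : ℚ_[3], (W.Δ : ℚ_[3]) = d ^ 3) ∧ ¬ ShapeIrrThree W := by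
  have hΔ : (W.baseChange ℚ_[3]).Δ = (W.Δ : ℚ_[3]) := by
    rw [WeierstrassCurve.baseChange, WeierstrassCurve.map_Δ]; rfl
  constructor
  · intro h
    refine ⟨exists_cube_eq_Δ_of_shapeSplitThree W h, ?_⟩
    obtain ⟨r, r', -, hr, -⟩ := h
    exact fun hirr ↦ hirr r hr
  · rintro ⟨⟨d, hd⟩, hnirr⟩
    obtain ⟨r, hr⟩ : ∃ r : ℚ_[3], ((W.baseChange ℚ_[3]).Ψ₃).IsRoot r := by
      unfold ShapeIrrThree at hnirr; push Not at hnirr; exact hnirr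
    obtain ⟨r', hne, hr'⟩ :=
      exists_second_root_of_Δ_eq_cube (W.baseChange ℚ_[3]) (d := d) (by rw [hΔ, hd]) hr
    exact ⟨r', r, hne, hr', hr⟩

end Curves

end Summit.BirchSwinnertonDyer.BirchSwinnertonDyer.Theorems.PSLocalThreeTorsion

end
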